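import Mathlib
import HarnessLib
import Summits.HubbardSuperconductivity.HubbardSuperconductivity.Theorems.EnslavedA1gIdentity

/-!
# Crux `NoOnsiteODLRO` (stmt-HubbardSuperconductivity-0933), line `registered` — helper stub T5a
# `stub_pairFieldCommutators`: `[P_s, P_{s'}ᴴ] = 2 T`

THE PAIR-FIELD COMMUTATOR. On the fermionic torus `(ℤ/Lℤ)²` with `L ≥ 3`,

  `P_s · P_{s'}ᴴ - P_{s'}ᴴ · P_s = 2 · T`,

where `P_s = pairField sWave L = √2 Σ_y c_{y↑} c_{y↓}` is the on-site pair field,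
`P_{s'} = pairField extendedSWave L = (1/√2) Σ_x Σ_{e ∈ unitSteps} (c_{x↑} c_{x+e,↓} - c_{x↓} c_{x+e,↑})`
the extended-`s` (A1g bond) pair field, and `T = hubbardTorus 2 L 1 0 = -Σ_{x} Σ_{e} Σ_σ c†_{xσ} c_{x+e,σ}`
the hopping operator (`stub_pairFieldCommutators`). It is the companion of the enslaving identity
`2 P_{s'} = [H, P_s] + U P_s` (`enslavedA1gIdentity_proof`) used by the two-sided Yang sandwich
(`stub_compressibilitySandwich`) to move addition-side pair correlations to the removal side.

Proof (CAR bookkeeping, no spectral input):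
* `[c_p c_q, c†_a c†_b] = δ_{qa} c_p c†_b - δ_{qb} c_p c†_a + δ_{pa} c†_b c_q - δ_{pb} c†_a c_q`
  (`pairAnnihilation_pairCreation_commutator`);
* summed over the on-site pairs, for `w ≠ x`:
  `Σ_y [c_{y↑} c_{y↓}, c†_{w↓} c†_{x↑} - c†_{w↑} c†_{x↓}] = -Σ_σ (c†_{xσ} c_{wσ} + c†_{wσ} c_{xσ})`
  (`onsitePairSum_commutator_bondPairCreation`; the two `δ_{wx}` terms vanish because `w = x + e ≠ x`,
  which is where `L ≥ 2` enters: `torusProj_ne_zero_of_mem_unitSteps`);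
* summed over `x` and `e ∈ unitSteps` this is `-(T' + T'ᴴ)` with `T' = Σ_{x,e,σ} c†_{xσ} c_{x+e,σ} = -T`
  for `L ≥ 3` (`hoppingSum_fermionTorus_eq`), and `T` is Hermitian (`hamiltonian_isHermitian`), so the
  commutator of the normalised sums is `√2 · (1/√2) · 2T = 2T`.

Sources: C. N. Yang, PRL 63 (1989) 2144 (the `η` commutators); S. C. Zhang, PRB 42 (1990) 1012 and
PRL 65 (1990) 120 (pseudospin equation of motion); G.-S. Tian, J. Phys. A 27 (1994) 6677;
D. J. Scalapino, Phys. Rep. 250 (1995) 329, §2 (pair fields). The computation is folklore; no definition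
is introduced.
-/

noncomputable section

namespace Summit.HubbardSuperconductivity.NoOnsiteODLRO.Sandwich

open Matrix Finset
open scoped ComplexOrder
open Literature.Probability.LatticeModels Literature.MathematicalPhysics.QuantumLattice
open Summit.HubbardSuperconductivity.EnslavedA1g

/-! ### CAR bookkeeping -/

section CAR

variable {ι : Type*} [LinearOrder ι] [Fintype ι]

/-- `[c_p c_q, c†_a c†_b] = δ_{qa} c_p c†_b - δ_{qb} c_p c†_a + δ_{pa} c†_b c_q - δ_{pb} c†_a c_q`
(from `[AB, CD] = A{B,C}D - AC{B,D} + {A,C}DB - C{A,D}B` and the CAR `{c_i, c†_j} = δ_{ij}`).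
Essler et al., *The One-Dimensional Hubbard Model* (2005) §2.2, eq. (2.72); Yang, PRL 63 (1989) 2144,
eq. (5). [folklore] -/
theorem pairAnnihilation_pairCreation_commutator (p q a b : ι) :
    annihilation p * annihilation q * (creation a * creation b) -
        creation a * creation b * (annihilation p * annihilation q) =
      (if q = a then annihilation p * creation b else 0) -
        (if q = b then annihilation p * creation a else 0) +
        (if p = a then creation b * annihilation q else 0) -
        (if p = b then creation a * annihilation q else 0) := by
  have key : ∀ i j : ι, annihilation i * creation j + creation j * annihilation i -
      (if i = j then (1 : Matrix (Finset ι) (Finset ι) ℂ) else 0) = 0 := fun i j => by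
    rw [annihilation_mul_creation i j]; abel
  rw [← sub_eq_zero]
  calc annihilation p * annihilation q * (creation a * creation b) -
        creation a * creation b * (annihilation p * annihilation q) -
        ((if q = a then annihilation p * creation b else 0) -
          (if q = b then annihilation p * creation a else 0) +
          (if p = a then creation b * annihilation q else 0) -
          (if p = b then creation a * annihilation q else 0))
      = annihilation p * (annihilation q * creation a + creation a * annihilation q -
            (if q = a then (1 : Matrix (Finset ι) (Finset ι) ℂ) else 0)) * creation b -
          annihilation p * creation a * (annihilation q * creation b + creation b * annihilation q -
            (if q = b then (1 : Matrix (Finset ι) (Finset ι) ℂ) else 0)) * 1 +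
          1 * (annihilation p * creation a + creation a * annihilation p -
            (if p = a then (1 : Matrix (Finset ι) (Finset ι) ℂ) else 0)) *
            (creation b * annihilation q) -
          creation a * (annihilation p * creation b + creation b * annihilation p -
            (if p = b then (1 : Matrix (Finset ι) (Finset ι) ℂ) else 0)) * annihilation q := by
        simp only [mul_sub, sub_mul, mul_add, add_mul, mul_ite, ite_mul, one_mul, mul_one, mul_zero,
          zero_mul, Matrix.mul_assoc]
        abel
    _ = 0 := by rw [key, key, key, key]; simp

variable {Λ : Type*} [LinearOrder Λ] [Fintype Λ]

/-- **The on-site pair sum against one singlet bond-pair creator.** For distinct sites `w ≠ x`: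
`Σ_y [c_{y↑} c_{y↓}, c†_{w↓} c†_{x↑} - c†_{w↑} c†_{x↓}] = -Σ_σ (c†_{xσ} c_{wσ} + c†_{wσ} c_{xσ})`
(only `y = w` and `y = x` contribute; the two identity terms `δ_{wx}` vanish).
Zhang, PRL 65 (1990) 120 (pseudospin equation of motion); Yang, PRL 63 (1989) 2144. [folklore] -/
theorem onsitePairSum_commutator_bondPairCreation {x w : Λ} (hwx : w ≠ x) :
    (∑ y : Λ, annihilation (orb y 0) * annihilation (orb y 1)) *
          (creation (orb w 1) * creation (orb x 0) - creation (orb w 0) * creation (orb x 1)) -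
        (creation (orb w 1) * creation (orb x 0) - creation (orb w 0) * creation (orb x 1)) *
          (∑ y : Λ, annihilation (orb y 0) * annihilation (orb y 1)) =
      -∑ σ : Fin 2, (creation (orb x σ) * annihilation (orb w σ) +
        creation (orb w σ) * annihilation (orb x σ)) := by
  rw [Finset.sum_mul, Finset.mul_sum, ← Finset.sum_sub_distrib]
  have hterm : ∀ y : Λ,
      annihilation (orb y 0) * annihilation (orb y 1) *
            (creation (orb w 1) * creation (orb x 0) - creation (orb w 0) * creation (orb x 1)) -
          (creation (orb w 1) * creation (orb x 0) - creation (orb w 0) * creation (orb x 1)) *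
            (annihilation (orb y 0) * annihilation (orb y 1)) =
        ((if y = w then annihilation (orb y 0) * creation (orb x 0) else 0) -
            (if y = x then creation (orb w 1) * annihilation (orb y 1) else 0)) -
          ((if y = w then creation (orb x 1) * annihilation (orb y 1) else 0) -
            (if y = x then annihilation (orb y 0) * creation (orb w 0) else 0)) := by
    intro y
    rw [mul_sub, sub_mul, sub_sub_sub_comm, pairAnnihilation_pairCreation_commutator,
      pairAnnihilation_pairCreation_commutator]
    simp only [orb_eq_orb_iff, and_true, and_false, if_false, sub_zero, add_zero, zero_sub,
      Fin.zero_eq_one_iff, OfNat.ofNat_ne_one, one_ne_zero]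
    abel
  simp only [hterm, Finset.sum_sub_distrib, Finset.sum_ite_eq', Finset.mem_univ, if_true]
  rw [annihilation_mul_creation (orb w 0) (orb x 0), annihilation_mul_creation (orb x 0) (orb w 0),
    if_neg (fun h => hwx (orb_eq_orb_iff.1 h).1), if_neg (fun h => hwx (orb_eq_orb_iff.1 h).1.symm),
    Fin.sum_univ_two]
  noncomm_ring

end CAR

/-! ### Torus bookkeeping -/

section Torus

variable {L : ℕ} [NeZero L]

omit [NeZero L] in
/-- For `L ≥ 2` the four unit steps project to NONZERO elements of `(ℤ/Lℤ)²` (`1 ≠ 0` in `ℤ/Lℤ`).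
Friedli–Velenik (2017) §3.1. [folklore] -/
theorem torusProj_ne_zero_of_mem_unitSteps (hL : 2 ≤ L) {e : Site 2} (he : e ∈ unitSteps) :
    Torus.proj L e ≠ (0 : TorusSite 2 L) := by
  haveI : Fact (1 < L) := ⟨by omega⟩
  simp only [unitSteps, mem_insert, mem_singleton] at he
  intro h
  rcases he with rfl | rfl | rfl | rfl
  · have h0 := congrFun h 0
    simp at h0
  · have h0 := congrFun h 0
    simp at h0
  · have h0 := congrFun h 1
    simp at h0
  · have h0 := congrFun h 1
    simp at h0

omit [NeZero L] in
/-- `x + π_L e ≠ x` on the fermionic torus for `e ∈ unitSteps`, `L ≥ 2`. [folklore] -/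
theorem ofTorusSite_add_proj_ne [NeZero L] (hL : 2 ≤ L) (x : TorusSite 2 L) {e : Site 2}
    (he : e ∈ unitSteps) :
    FermionTorus.ofTorusSite (x + Torus.proj L e) ≠ FermionTorus.ofTorusSite x := by
  rw [Ne, ofTorusSite_eq_iff]
  intro h
  exact torusProj_ne_zero_of_mem_unitSteps hL he (by simpa using h)

/-- The on-site pair sum re-indexed from the statistical-mechanics torus `(ℤ/Lℤ)²` to the fermionic
torus (`FermionTorus.equivTorusSite`). [folklore] -/
theorem onsitePairSum_torusSite_eq :
    (∑ y : TorusSite 2 L, annihilation (orb (FermionTorus.ofTorusSite y) 0) *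
        annihilation (orb (FermionTorus.ofTorusSite y) 1)) =
      ∑ y : FermionTorus 2 L, annihilation (orb y 0) * annihilation (orb y 1) :=
  Fintype.sum_equiv FermionTorus.equivTorusSite.symm _ _ fun _ => rfl

/-- The unit-step hopping sum `T' = Σ_x Σ_{e ∈ unitSteps} Σ_σ c†_{xσ} c_{x+e,σ}` is `-T`,
`T = hubbardTorus 2 L 1 0`, for `L ≥ 3` (`hoppingSum_fermionTorus_eq`). Lieb–Wu (1968);
Friedli–Velenik (2017) §3.1. [folklore] -/
theorem hubbardTorus_one_zero_eq (hL : 3 ≤ L) :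
    hubbardTorus 2 L 1 0 =
      -∑ x : TorusSite 2 L, ∑ e ∈ unitSteps, ∑ σ : Fin 2,
        creation (orb (FermionTorus.ofTorusSite x) σ) *
          annihilation (orb (FermionTorus.ofTorusSite (x + Torus.proj L e)) σ) := by
  unfold hubbardTorus hamiltonian
  rw [hoppingSum_fermionTorus_eq hL, Complex.ofReal_one, neg_smul, one_smul, Complex.ofReal_zero,
    zero_smul, add_zero]

/-- The reversed unit-step hopping sum is the adjoint of `T'`:
`Σ_x Σ_e Σ_σ c†_{x+e,σ} c_{xσ} = (Σ_x Σ_e Σ_σ c†_{xσ} c_{x+e,σ})ᴴ`. [folklore] -/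
theorem hoppingSum_reversed_eq_conjTranspose :
    (∑ x : TorusSite 2 L, ∑ e ∈ unitSteps, ∑ σ : Fin 2,
        creation (orb (FermionTorus.ofTorusSite (x + Torus.proj L e)) σ) *
          annihilation (orb (FermionTorus.ofTorusSite x) σ)) =
      (∑ x : TorusSite 2 L, ∑ e ∈ unitSteps, ∑ σ : Fin 2,
        creation (orb (FermionTorus.ofTorusSite x) σ) *
          annihilation (orb (FermionTorus.ofTorusSite (x + Torus.proj L e)) σ))ᴴ := by
  simp only [conjTranspose_sum, conjTranspose_mul, creation_conjTranspose, annihilation_conjTranspose]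

omit [NeZero L] in
/-- `T = hubbardTorus 2 L 1 0` is Hermitian. Lieb, PRL 62 (1989) 1201, eq. (1). [folklore] -/
theorem hubbardTorus_one_zero_conjTranspose : (hubbardTorus 2 L 1 0)ᴴ = hubbardTorus 2 L 1 0 :=
  (LiebThm1.hamiltonian_isHermitian (fermionTorusGraph 2 L) 1 0).eq

end Torus

/-! ### The stub -/

section Main

variable {L : ℕ} [NeZero L]

/-- **`[Δ, Δ_{s'}ᴴ] = 2T` for the unnormalised sums** (`L ≥ 3`):
`Δ = Σ_y c_{y↑} c_{y↓}`, `Δ_{s'}ᴴ = Σ_x Σ_e (c†_{x+e,↓} c†_{x↑} - c†_{x+e,↑} c†_{x↓})`, `T = hubbardTorus 2 L 1 0`.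
Zhang, PRB 42 (1990) 1012; Yang, PRL 63 (1989) 2144; Tian, J. Phys. A 27 (1994) 6677. [folklore] -/
theorem onsitePairSum_commutator_bondPairSum_conjTranspose (hL : 3 ≤ L) :
    (∑ y : TorusSite 2 L, annihilation (orb (FermionTorus.ofTorusSite y) 0) *
          annihilation (orb (FermionTorus.ofTorusSite y) 1)) *
        (∑ x : TorusSite 2 L, ∑ e ∈ unitSteps,
          (creation (orb (FermionTorus.ofTorusSite (x + Torus.proj L e)) 1) *
              creation (orb (FermionTorus.ofTorusSite x) 0) -
            creation (orb (FermionTorus.ofTorusSite (x + Torus.proj L e)) 0) *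
              creation (orb (FermionTorus.ofTorusSite x) 1))) -
      (∑ x : TorusSite 2 L, ∑ e ∈ unitSteps,
          (creation (orb (FermionTorus.ofTorusSite (x + Torus.proj L e)) 1) *
              creation (orb (FermionTorus.ofTorusSite x) 0) -
            creation (orb (FermionTorus.ofTorusSite (x + Torus.proj L e)) 0) *
              creation (orb (FermionTorus.ofTorusSite x) 1))) *
        (∑ y : TorusSite 2 L, annihilation (orb (FermionTorus.ofTorusSite y) 0) *
          annihilation (orb (FermionTorus.ofTorusSite y) 1)) =
      (2 : ℂ) • hubbardTorus 2 L 1 0 := by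
  set Δ : Matrix (Finset (Orb (FermionTorus 2 L))) (Finset (Orb (FermionTorus 2 L))) ℂ :=
    ∑ y : TorusSite 2 L, annihilation (orb (FermionTorus.ofTorusSite y) 0) *
      annihilation (orb (FermionTorus.ofTorusSite y) 1) with hΔ
  set T' : Matrix (Finset (Orb (FermionTorus 2 L))) (Finset (Orb (FermionTorus 2 L))) ℂ :=
    ∑ x : TorusSite 2 L, ∑ e ∈ unitSteps, ∑ σ : Fin 2,
      creation (orb (FermionTorus.ofTorusSite x) σ) *
        annihilation (orb (FermionTorus.ofTorusSite (x + Torus.proj L e)) σ) with hT'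
  have hcomm : Δ * (∑ x : TorusSite 2 L, ∑ e ∈ unitSteps,
          (creation (orb (FermionTorus.ofTorusSite (x + Torus.proj L e)) 1) *
              creation (orb (FermionTorus.ofTorusSite x) 0) -
            creation (orb (FermionTorus.ofTorusSite (x + Torus.proj L e)) 0) *
              creation (orb (FermionTorus.ofTorusSite x) 1))) -
      (∑ x : TorusSite 2 L, ∑ e ∈ unitSteps,
          (creation (orb (FermionTorus.ofTorusSite (x + Torus.proj L e)) 1) *
              creation (orb (FermionTorus.ofTorusSite x) 0) -
            creation (orb (FermionTorus.ofTorusSite (x + Torus.proj L e)) 0) *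
              creation (orb (FermionTorus.ofTorusSite x) 1))) * Δ =
      -(T' + T'ᴴ) := by
    rw [hT', ← hoppingSum_reversed_eq_conjTranspose, ← Finset.sum_add_distrib, ← Finset.sum_neg_distrib,
      Finset.mul_sum, Finset.sum_mul, ← Finset.sum_sub_distrib]
    refine Finset.sum_congr rfl fun x _ => ?_
    rw [← Finset.sum_add_distrib, ← Finset.sum_neg_distrib, Finset.mul_sum, Finset.sum_mul,
      ← Finset.sum_sub_distrib]
    refine Finset.sum_congr rfl fun e he => ?_
    rw [hΔ, onsitePairSum_torusSite_eq,
      onsitePairSum_commutator_bondPairCreation (ofTorusSite_add_proj_ne (by omega) x he),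
      ← Finset.sum_add_distrib]
  rw [hcomm, hT', ← neg_eq_iff_eq_neg.2 (hubbardTorus_one_zero_eq hL), conjTranspose_neg,
    hubbardTorus_one_zero_conjTranspose, ← neg_add, neg_neg, two_smul]

/-- `√2 · (1/√2) = 1` in `ℂ`. [folklore] -/
theorem ofReal_sqrt_two_mul_inv_sqrt_two :
    ((Real.sqrt 2 : ℝ) : ℂ) * ((1 / Real.sqrt 2 : ℝ) : ℂ) = 1 := by
  rw [← Complex.ofReal_mul, mul_one_div_cancel (Real.sqrt_ne_zero'.2 two_pos), Complex.ofReal_one]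

/-- **Helper stub T5a of line `registered` for crux `NoOnsiteODLRO` — the pair-field commutator.**
On the fermionic torus `(ℤ/Lℤ)²` with `L ≥ 3`:
`pairField sWave L * (pairField extendedSWave L)ᴴ - (pairField extendedSWave L)ᴴ * pairField sWave L
  = 2 • hubbardTorus 2 L 1 0`,
i.e. `[P_s, P_{s'}ᴴ] = 2T`: the commutator of the on-site pair field with the adjoint of the extended-`s`
bond pair field is twice the hopping operator (normal forms `P_s = √2 Σ_y c_{y↑}c_{y↓}`,
`P_{s'} = (1/√2) Σ_x Σ_e (c_{x↑}c_{x+e,↓} - c_{x↓}c_{x+e,↑})`, and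
`onsitePairSum_commutator_bondPairSum_conjTranspose`). Yang, PRL 63 (1989) 2144; Zhang, PRB 42 (1990)
1012; Tian, J. Phys. A 27 (1994) 6677. [folklore] -/
theorem stub_pairFieldCommutators :
    ∀ (L : ℕ) [NeZero L], 2 < L →
      pairField sWave L * (pairField extendedSWave L)ᴴ - (pairField extendedSWave L)ᴴ * pairField sWave L =
        (2 : ℂ) • hubbardTorus 2 L 1 0 := by
  intro L _ hL
  have hstar : star ((1 / Real.sqrt 2 : ℝ) : ℂ) = ((1 / Real.sqrt 2 : ℝ) : ℂ) := by
    rw [Complex.star_def, Complex.conj_ofReal]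
  have hct : (pairField extendedSWave L)ᴴ = ((1 / Real.sqrt 2 : ℝ) : ℂ) •
      ∑ x : TorusSite 2 L, ∑ e ∈ unitSteps,
        (creation (orb (FermionTorus.ofTorusSite (x + Torus.proj L e)) 1) *
            creation (orb (FermionTorus.ofTorusSite x) 0) -
          creation (orb (FermionTorus.ofTorusSite (x + Torus.proj L e)) 0) *
            creation (orb (FermionTorus.ofTorusSite x) 1)) := by
    rw [pairField_extendedSWave_eq, conjTranspose_smul, hstar]
    simp only [conjTranspose_sum, conjTranspose_sub, conjTranspose_mul, annihilation_conjTranspose]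
  rw [hct, pairField_sWave_eq, smul_mul_smul_comm, smul_mul_smul_comm, mul_comm ((1 / Real.sqrt 2 : ℝ) : ℂ),
    ofReal_sqrt_two_mul_inv_sqrt_two, one_smul, one_smul,
    onsitePairSum_commutator_bondPairSum_conjTranspose (by omega)]

end Main

end Summit.HubbardSuperconductivity.NoOnsiteODLRO.Sandwich

end
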